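import Summits.ABC.StewartYu.PadicG3SatNSizes
import HarnessLib

/-!
# Cell abc-stewartyu, WP-L.P(odd) (crux r3 `PadicCoreOddRat`, stmt-ABC-20503): the START entry bound, the Siegel coefficient bound and the
# k-step Liouville constant of the saturated pack on `schedN b`, in closed log-linear form

`Summits/ABC/StewartYu/PadicG3SatNSizesB.lean` — cell `abc-stewartyu` (seat p2-g6, pack twin step 3; record owner p1 g10; R28(d)/R31(a)).
Proofs only; no definition, no named fact.  Twin of `PadicG3VbSizesB` (p3-g7) for `F : S.SatData` on `P.schedN b`, BUDGET-PARAMETRIC: the START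
order and the directional log enter through two abstract majorants the budget file instantiates —
`T0r ≥ TordS (schedN b) 0 0` (p1: `≤ (69/4)(n+1)LgV + 2(n+1)(ŜN − ŜG)`) and `cX ≥ log 2 + 3 log n + log n! + log N + W + log LV`
(the θ-box directional log of `PadicG3SatNSizes.XbC_LcS_N_le_exp`); the class count enters as `ℓU = log(L0N+1) + n·log(n·n!·N·LV+1)`.

* `log_XbSSat_N_le'` (`log XbSSat ≤ cX`), `log_max_one_XbC_LcS_N_le` (`log max(1, XbC(Lb LcS lev)) ≤ cX`);
* `log_AmaxSat_N_le`: `log AmaxSat ≤ log 2 + T0r·(ŜN log 2 + (23/20)HV + cX) + HV/e + L0N(ŜN+n+6) log 2 + 2·htsV 0 + 4ΣA`;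
* `PmaxSat_le_two_mul`, `log_PmaxSat_N_le`;
* `log_KCsat_N_le`: at an admissible stage-`ν` target,
  `log KCsat ≤ 4 log 2 + 2ℓU + 2·T0r·(ŜN log 2 + (23/20)HV + cX) + 2·HV/e + 2·L0N(ŜN+n+6) log 2 + 2·htsV 0 + 4·htsV ν + 8ΣA`.

WHAT THIS IS NOT: the budget comparison with `Zp` (p1's atoms; next file); no crux moves.

References: Yu. V. Nesterenko, LNM 1819 (2003) Prop 3.9 (3.40), §4.2 (4.31)–(4.35); K. Yu, Acta Math. 211 (2013) §5.
-/

noncomputable section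

open Finset Real
open Literature.NumberTheory.Transcendental
open Literature.NumberTheory.Transcendental.CW77.Setup (Tau tauNorm)

namespace Summit.ABC.StewartYu

namespace G3Setup

variable {p : ℕ} [Fact p.Prime] (S : G3Setup p) (F : S.SatData) (P : PadicG3ParN S.n) (b : ℝ)

/-- `0 ≤ cX` for any majorant of the directional log (its minorant is a sum of non-negative logs and `W ≥ 1`). [folklore] -/
theorem cX_nonneg (hn : 1 ≤ S.n) {cX : ℝ}
    (hcX : Real.log 2 + 3 * Real.log S.n + Real.log S.n.factorial + Real.log F.N + P.W + Real.log P.LV ≤ cX) : 0 ≤ cX := by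
  have h1 : 0 ≤ Real.log 2 := Real.log_nonneg (by norm_num)
  have h2 : 0 ≤ Real.log (S.n : ℝ) := Real.log_nonneg (by exact_mod_cast hn)
  have h3 : 0 ≤ Real.log (P.LV : ℝ) := Real.log_nonneg P.one_le_LV
  have h4 : 0 ≤ Real.log (S.n.factorial : ℝ) := Real.log_nonneg (by exact_mod_cast S.n.factorial_pos)
  have h5 : 0 ≤ Real.log (F.N : ℝ) := Real.log_nonneg (by exact_mod_cast F.hN)
  linarith [P.hW]

/-- `log XbSSat ≤ cX`. [folklore] -/
theorem log_XbSSat_N_le' (hb : 1 ≤ b) (hn : 1 ≤ S.n) (hA1 : ∀ j, 1 ≤ P.A j) (hbW : ∀ j, Real.log (max 3 (|S.b j| : ℝ)) ≤ P.W)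
    (hC : ∀ j k, |F.C j k| ≤ ((S.n.factorial * F.N : ℕ) : ℤ)) {cX : ℝ}
    (hcX : Real.log 2 + 3 * Real.log S.n + Real.log S.n.factorial + Real.log F.N + P.W + Real.log P.LV ≤ cX) :
    Real.log (S.XbSSat F (P.schedN b) : ℝ) ≤ cX := by
  have h := S.XbSSat_N_le F P b hb hn hA1 hbW hC
  have h1 : (1 : ℝ) ≤ (S.XbSSat F (P.schedN b) : ℝ) := by rw [S.XbSSat_cast]; exact le_max_left _ _
  have hlog := Real.log_le_log (by linarith) h
  rw [Real.log_exp] at hlog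
  exact hlog.trans hcX

/-- `log max(1, XbC (Lb LcS lev)) ≤ cX`. [folklore] -/
theorem log_max_one_XbC_LcS_N_le (hb : 1 ≤ b) (hn : 1 ≤ S.n) (hA1 : ∀ j, 1 ≤ P.A j) (hbW : ∀ j, Real.log (max 3 (|S.b j| : ℝ)) ≤ P.W)
    (hC : ∀ j k, |F.C j k| ≤ ((S.n.factorial * F.N : ℕ) : ℤ)) {cX : ℝ}
    (hcX : Real.log 2 + 3 * Real.log S.n + Real.log S.n.factorial + Real.log F.N + P.W + Real.log P.LV ≤ cX) (lev : ℕ) :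
    Real.log (max 1 (S.XbC (S.Lb (S.LcS F (P.schedN b)) lev) : ℝ)) ≤ cX := by
  have h := S.XbC_LcS_N_le_exp F P b hb hn hA1 hbW hC lev
  have hmax : max 1 (S.XbC (S.Lb (S.LcS F (P.schedN b)) lev) : ℝ) ≤
      Real.exp (Real.log 2 + 3 * Real.log S.n + Real.log S.n.factorial + Real.log F.N + P.W + Real.log P.LV) :=
    max_le (Real.one_le_exp (S.cX_nonneg F P hn le_rfl)) h
  have hlog := Real.log_le_log (lt_of_lt_of_le zero_lt_one (le_max_left _ _)) hmax
  rw [Real.log_exp] at hlog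
  exact hlog.trans hcX

/-- **The START entry bound**: `log AmaxSat ≤ log 2 + T0r·(ŜN log 2 + (23/20)HV + cX) + HV/e + L0N(ŜN+n+6)·log 2 + 2·htsV 0 + 4·ΣA`.
[cite: Nesterenko2003, Prop 3.9 (3.40); shape only] -/
theorem log_AmaxSat_N_le (hb : 1 ≤ b) (hn : 1 ≤ S.n) (hA1 : ∀ j, 1 ≤ P.A j) (hαA : ∀ j, Height.logHeight₁ (F.αo j) ≤ P.A j)
    (hbW : ∀ j, Real.log (max 3 (|S.b j| : ℝ)) ≤ P.W) (hC : ∀ j k, |F.C j k| ≤ ((S.n.factorial * F.N : ℕ) : ℤ))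
    {T0r : ℝ} (hT0 : (S.TordS (P.schedN b) 0 0 : ℝ) ≤ T0r) {cX : ℝ}
    (hcX : Real.log 2 + 3 * Real.log S.n + Real.log S.n.factorial + Real.log F.N + P.W + Real.log P.LV ≤ cX) :
    Real.log (S.AmaxSat F (P.schedN b)) ≤ Real.log 2 + T0r * (P.SdN * Real.log 2 + 23 / 20 * P.HV + cX) + P.HV / Real.exp 1 +
      P.L0N * ((P.SdN + S.n + 6) * Real.log 2) + 2 * P.htsV 0 + 4 * ∑ j, P.A j := by
  set X₀ : ℕ := S.NS (P.schedN b) 0 0 with hX₀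
  set T₀ : ℕ := S.TordS (P.schedN b) 0 0 with hT₀
  have hT₀0 : (0 : ℝ) ≤ T₀ := Nat.cast_nonneg _
  have hcX0 := S.cX_nonneg F P hn hcX
  rw [S.log_AmaxSat_eq F (P.schedN b)]
  simp only [PadicG3ParN.schedN_L₀, PadicG3ParN.schedN_H, PadicG3ParN.schedN_Sd]
  rw [← hX₀, ← hT₀]
  -- M0C
  have hx : (|((X₀ : ℕ) : ℤ)| : ℝ) ≤ 2 ^ (0 + S.n) * (9 * P.HV) := by
    have h := S.NS00_N_le_HV P b
    push_cast; rw [abs_of_nonneg (by positivity)]; exact h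
  have hM := log_M0C_le_sharp P.L0N P.HV P.SdN 0 (X₀ : ℤ) T₀
  have hL := S.L0_factor_N_le P (Nat.zero_le _) hx
  simp only [Nat.sub_zero] at hM hL
  -- XbSSat
  have hXb := S.log_XbSSat_N_le' F P b hb hn hA1 hbW hC hcX
  -- Dm at the START
  have hDm : Real.log (F.Dm (S.Lb (S.svS F (P.schedN b)) 0) (X₀ : ℤ) : ℝ) ≤ P.htsV 0 + 2 * ∑ j, P.A j := by
    have h1 := S.log_Dm_N_le F P b hb hαA 0 (X₀ : ℤ)
    have h2 := S.start_height_N_le P b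
    rw [← hX₀] at h2
    push_cast at h1
    rw [abs_of_nonneg (by positivity), pow_zero, div_one] at h1
    linarith
  -- assemble
  have hHV : (0 : ℝ) ≤ P.HV := by positivity
  have hSd : (0 : ℝ) ≤ P.SdN * Real.log 2 := mul_nonneg (Nat.cast_nonneg _) (Real.log_nonneg (by norm_num))
  have hcoef : (0 : ℝ) ≤ P.SdN * Real.log 2 + 23 / 20 * P.HV + cX := by positivity
  have key : (T₀ : ℝ) * (P.SdN * Real.log 2 + 23 / 20 * P.HV) + T₀ * cX ≤ T0r * (P.SdN * Real.log 2 + 23 / 20 * P.HV + cX) := by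
    have : (T₀ : ℝ) * (P.SdN * Real.log 2 + 23 / 20 * P.HV) + T₀ * cX = T₀ * (P.SdN * Real.log 2 + 23 / 20 * P.HV + cX) := by ring
    rw [this]
    exact mul_le_mul_of_nonneg_right hT0 hcoef
  nlinarith [mul_le_mul_of_nonneg_left hXb hT₀0, key, hM, hL, hDm]

/-- `1 ≤ PmaxSat` and `PmaxSat ≤ 2·UcardSat·AmaxSat`. [folklore] -/
theorem PmaxSat_le_two_mul (Sc : G3Sched S.n) :
    (1 : ℝ) ≤ (S.PmaxSat F Sc : ℝ) ∧ (S.PmaxSat F Sc : ℝ) ≤ 2 * ((S.UcardSat F Sc : ℝ) * S.AmaxSat F Sc) := by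
  have hU : (1 : ℝ) ≤ (S.UcardSat F Sc : ℝ) := by exact_mod_cast S.one_le_UcardSat F Sc
  have hA := S.one_le_AmaxSat F Sc
  have hUA : (1 : ℝ) ≤ (S.UcardSat F Sc : ℝ) * S.AmaxSat F Sc := by nlinarith
  constructor
  · have : (1 : ℤ) ≤ S.PmaxSat F Sc := by unfold PmaxSat; exact Int.one_le_ceil_iff.mpr (by linarith)
    exact_mod_cast this
  · unfold PmaxSat
    have h := Int.ceil_lt_add_one ((S.UcardSat F Sc : ℝ) * S.AmaxSat F Sc)
    linarith

/-- **The Siegel coefficient bound**: `log PmaxSat ≤ log 2 + ℓU + (START entry bound)`. [folklore] -/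
theorem log_PmaxSat_N_le (hb : 1 ≤ b) (hn : 1 ≤ S.n) (hA1 : ∀ j, 1 ≤ P.A j) (hαA : ∀ j, Height.logHeight₁ (F.αo j) ≤ P.A j)
    (hbW : ∀ j, Real.log (max 3 (|S.b j| : ℝ)) ≤ P.W) (hC : ∀ j k, |F.C j k| ≤ ((S.n.factorial * F.N : ℕ) : ℤ))
    {T0r : ℝ} (hT0 : (S.TordS (P.schedN b) 0 0 : ℝ) ≤ T0r) {cX : ℝ}
    (hcX : Real.log 2 + 3 * Real.log S.n + Real.log S.n.factorial + Real.log F.N + P.W + Real.log P.LV ≤ cX) :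
    Real.log (S.PmaxSat F (P.schedN b) : ℝ) ≤ Real.log 2 +
      (Real.log ((P.L0N : ℝ) + 1) + S.n * Real.log (S.n * S.n.factorial * F.N * P.LV + 1)) +
      (Real.log 2 + T0r * (P.SdN * Real.log 2 + 23 / 20 * P.HV + cX) + P.HV / Real.exp 1 +
        P.L0N * ((P.SdN + S.n + 6) * Real.log 2) + 2 * P.htsV 0 + 4 * ∑ j, P.A j) := by
  have hlog := S.log_PmaxSat_le F (P.schedN b)
  have hUl := S.log_UcardSat_N_le F P b hb hA1 hC
  have hAl := S.log_AmaxSat_N_le F P b hb hn hA1 hαA hbW hC hT0 hcX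
  linarith

/-- **The k-step Liouville constant of the saturated pack** at an admissible target of stage `ν`:
`log KCsat ≤ 4 log 2 + 2ℓU + 2·T0r·(ŜN log 2 + (23/20)HV + cX) + 2·HV/e + 2·L0N(ŜN+n+6) log 2 + 2·htsV 0 + 4·htsV ν + 8·ΣA`.
[cite: Nesterenko2003, §4.2 (4.34)–(4.35); shape only] -/
theorem log_KCsat_N_le (hb : 1 ≤ b) (hn : 1 ≤ S.n) (hA1 : ∀ j, 1 ≤ P.A j) (hαA : ∀ j, Height.logHeight₁ (F.αo j) ≤ P.A j)
    (hbW : ∀ j, Real.log (max 3 (|S.b j| : ℝ)) ≤ P.W) (hC : ∀ j k, |F.C j k| ≤ ((S.n.factorial * F.N : ℕ) : ℤ))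
    {T0r : ℝ} (hT0 : (S.TordS (P.schedN b) 0 0 : ℝ) ≤ T0r) {cX : ℝ}
    (hcX : Real.log 2 + 3 * Real.log S.n + Real.log S.n.factorial + Real.log F.N + P.W + Real.log P.LV ≤ cX)
    {lev ν : ℕ} (hlev : lev ≤ P.SdN) (hν : ν + 1 ≤ S.n) {x₁ : ℤ} (hx : |x₁| ≤ (S.NS (P.schedN b) lev (ν + 1) : ℤ))
    (τ : Tau S.n) (hτ : tauNorm τ ≤ S.TordS (P.schedN b) 0 0) :
    Real.log (S.KCsat F (S.UcardSat F (P.schedN b)) (S.PmaxSat F (P.schedN b)) P.L0N P.HV P.SdN lev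
        (S.Lb (S.LcS F (P.schedN b)) lev) (S.Lb (S.svS F (P.schedN b)) lev) x₁ τ) ≤
      4 * Real.log 2 + 2 * (Real.log ((P.L0N : ℝ) + 1) + S.n * Real.log (S.n * S.n.factorial * F.N * P.LV + 1)) +
      2 * (T0r * (P.SdN * Real.log 2 + 23 / 20 * P.HV + cX)) +
      2 * (P.HV / Real.exp 1) + 2 * (P.L0N * ((P.SdN + S.n + 6) * Real.log 2)) + 2 * P.htsV 0 + 4 * P.htsV ν + 8 * ∑ j, P.A j := by
  have hcX0 := S.cX_nonneg F P hn hcX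
  have hU1 : 1 ≤ S.UcardSat F (P.schedN b) := S.one_le_UcardSat F (P.schedN b)
  obtain ⟨hP1r, _⟩ := S.PmaxSat_le_two_mul F (P.schedN b)
  have hP1 : (1 : ℤ) ≤ S.PmaxSat F (P.schedN b) := by exact_mod_cast hP1r
  have h0 := S.log_KCsat_le F hU1 hP1 P.L0N P.HV P.SdN lev (S.Lb (S.LcS F (P.schedN b)) lev) (S.Lb (S.svS F (P.schedN b)) lev) x₁ τ
  -- the pieces
  have hUl := S.log_UcardSat_N_le F P b hb hA1 hC
  have hPl := S.log_PmaxSat_N_le F P b hb hn hA1 hαA hbW hC hT0 hcX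
  have hxr : (|x₁| : ℝ) ≤ 2 ^ (lev + S.n) * (9 * P.HV) := by
    have h1 : ((|x₁| : ℤ) : ℝ) ≤ ((S.NS (P.schedN b) lev (ν + 1) : ℤ) : ℝ) := by exact_mod_cast hx
    push_cast at h1
    exact h1.trans (S.NS_N_le_HV P b hν)
  have hM := log_M0C_le_sharp P.L0N P.HV P.SdN lev x₁ τ.1
  have hL := S.L0_factor_N_le P hlev hxr
  have hS : ((P.SdN - lev : ℕ) : ℝ) ≤ P.SdN := by exact_mod_cast Nat.sub_le _ _
  have hXl := S.log_max_one_XbC_LcS_N_le F P b hb hn hA1 hbW hC hcX lev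
  have hDl : Real.log (F.Dm (S.Lb (S.svS F (P.schedN b)) lev) x₁ : ℝ) ≤ 2 * P.htsV ν + 2 * ∑ j, P.A j := by
    have h1 := S.log_Dm_N_le F P b hb hαA lev x₁
    have h2 := S.nodes_height_N_le P b lev ν
    have hx' : |(x₁ : ℝ)| ≤ (S.NS (P.schedN b) lev (ν + 1) : ℝ) := by
      have : ((|x₁| : ℤ) : ℝ) ≤ ((S.NS (P.schedN b) lev (ν + 1) : ℤ) : ℝ) := by exact_mod_cast hx
      push_cast at this; exact this
    have h0 : (0 : ℝ) ≤ S.n * P.LV / 2 ^ lev := by positivity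
    nlinarith [mul_le_mul_of_nonneg_right hx' h0]
  -- the order budget of the target
  have hτr : ((τ.1 : ℝ) + ((∑ k, τ.2 k : ℕ) : ℝ)) ≤ T0r := by
    have : ((tauNorm τ : ℕ) : ℝ) ≤ (S.TordS (P.schedN b) 0 0 : ℝ) := by exact_mod_cast hτ
    unfold tauNorm at this; rw [Nat.cast_add] at this
    exact this.trans hT0
  have ht1 : (0 : ℝ) ≤ τ.1 := Nat.cast_nonneg _
  have ht2 : (0 : ℝ) ≤ ((∑ k, τ.2 k : ℕ) : ℝ) := Nat.cast_nonneg _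
  have hHV : (0 : ℝ) ≤ P.HV := by positivity
  have hSd : (0 : ℝ) ≤ P.SdN * Real.log 2 := mul_nonneg (Nat.cast_nonneg _) (Real.log_nonneg (by norm_num))
  have hl2 : 0 ≤ Real.log 2 := Real.log_nonneg (by norm_num)
  have hcoef : (0 : ℝ) ≤ P.SdN * Real.log 2 + 23 / 20 * P.HV + cX := by positivity
  have hτsum : (τ.1 : ℝ) * (P.SdN * Real.log 2 + 23 / 20 * P.HV) + ((∑ k, τ.2 k : ℕ) : ℝ) * cX ≤
      T0r * (P.SdN * Real.log 2 + 23 / 20 * P.HV + cX) := by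
    calc (τ.1 : ℝ) * (P.SdN * Real.log 2 + 23 / 20 * P.HV) + ((∑ k, τ.2 k : ℕ) : ℝ) * cX
        ≤ τ.1 * (P.SdN * Real.log 2 + 23 / 20 * P.HV + cX) + ((∑ k, τ.2 k : ℕ) : ℝ) * (P.SdN * Real.log 2 + 23 / 20 * P.HV + cX) :=
          add_le_add (mul_le_mul_of_nonneg_left (by linarith) ht1) (mul_le_mul_of_nonneg_left (by linarith) ht2)
      _ = ((τ.1 : ℝ) + ((∑ k, τ.2 k : ℕ) : ℝ)) * (P.SdN * Real.log 2 + 23 / 20 * P.HV + cX) := by ring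
      _ ≤ _ := mul_le_mul_of_nonneg_right hτr hcoef
  -- M0C at the node: `log M0C ≤ log 2 + τ.1·(ŜN log 2 + 23/20 HV) + HV/e + L0N(ŜN+n+6) log 2`
  have hMl : Real.log (M0C P.L0N P.HV P.SdN lev x₁ τ.1 : ℝ) ≤
      Real.log 2 + τ.1 * (P.SdN * Real.log 2 + 23 / 20 * P.HV) + P.HV / Real.exp 1 + P.L0N * ((P.SdN + S.n + 6) * Real.log 2) := by
    nlinarith [mul_le_mul_of_nonneg_right hS (mul_nonneg ht1 hl2), hM, hL]
  have hXt : ((∑ k, τ.2 k : ℕ) : ℝ) * Real.log (max 1 (S.XbC (S.Lb (S.LcS F (P.schedN b)) lev) : ℝ)) ≤ ((∑ k, τ.2 k : ℕ) : ℝ) * cX :=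
    mul_le_mul_of_nonneg_left hXl ht2
  linarith [h0, hUl, hPl, hMl, hXt, hDl, hτsum]

end G3Setup

end Summit.ABC.StewartYu

end
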